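import Literature.Probability.RandomPlanarGeometry.SLERestrictionHitAssembly
import Literature.Probability.RandomPlanarGeometry.SLERestrictionHitPathTendsto
import HarnessLib

/-!
# [LSW] Lemma 6.3 from the hit-path and access-arc facts

The assembly: for a smooth `*`-hull `A` first hit by the Loewner hull at time `T` (no real point
of `A` swallowed), `Φ'_{g_t(A) - W_t}(0) → 0` as `t ↗ T`
(`IsSmoothHull.restrictionDerivVanishesAtHit`), from

* the multi-scale estimate `restrictionDeriv_le_pow` (`RestrictionDerivMultiScale`) applied to
  the slid chain sets `g_t(Γ_{x_k}) - W_t` (`SLERestrictionHitChain`, `SLERestrictionHitScales`,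
  `SLERestrictionHitAssembly`), for `t < T` in the window given by uniform convergence
  `g_t → g_T` on `Γ_{x_N}` (`LoewnerUniformContinuity`);
* the named facts `IsSmoothHull.hitPath_tendsto`, `IsSmoothHull.hitPath_stolz`
  (`SLERestrictionHitPath`: the image of a smooth hit path under `g_T - W_T` tends to `0`
  inside a Stolz cone) and `IsSmoothHullWith.exists_smoothHitPath`, `IsArcHull.exists_accessArc`
  (`SLERestrictionHitPathAccess`).

Main results: `IsChainData.eventually_restrictionDeriv_lt`,
`restrictionDerivVanishesAtHit_of_facts`, and — with `IsSmoothHull.hitPath_tendsto` discharged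
(`SLERestrictionHitPathTendsto`) — `restrictionDerivVanishesAtHit_of_stolz_access`, which leaves
three named facts.
-/

noncomputable section

open Set Filter Metric Complex
open _root_.Topology
open UpperHalfPlane (upperHalfPlaneSet isOpen_upperHalfPlaneSet)
open Literature.Topology.PlaneTopology Literature.Analysis.Complex
open scoped NNReal unitInterval

namespace Literature.Probability.RandomPlanarGeometry

section Final

variable {W : ℝ≥0 → ℝ} {A Λ : Set ℂ} {β : ℝ → ℂ} {xb xs : ℝ} {τ : ℝ≥0}

/-- **`Φ'_{g_t(A) - W_t}(0) < ε` for `t < T` close to `T`**, given chain data whose path `β`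
is mapped by `g_T - W_T` to a path tending to `0` inside a Stolz cone. [cite: LawlerSchrammWerner2003Restriction, proof of Lemma 6.3] -/
theorem IsChainData.eventually_restrictionDeriv_lt (h : IsChainData A Λ β xb xs) (hW : Continuous W)
    (hA : IsStarHull A) (hAarc : IsArcHull A) (hτ : Loewner.IsHullHitTime W A τ)
    (hreal : ∀ x : ℝ, (x : ℂ) ∈ A → ¬ Loewner.swallowingTime W x ≤ (τ : WithTop ℝ≥0))
    (hlim : Tendsto (fun x ↦ Loewner.map W τ (β x) - W τ) (𝓝[<] 1) (𝓝 0))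
    {c₁ : ℝ} (hc₁ : 1 ≤ c₁)
    (hstolz : ∀ y ∈ Ico (0 : ℝ) 1, |(Loewner.map W τ (β y) - W τ).re| ≤ c₁ * (Loewner.map W τ (β y) - W τ).im)
    {ε : ℝ} (hε : 0 < ε) :
    ∀ᶠ t : ℝ≥0 in 𝓝[<] τ,
      ∀ (Ψ : ConformalEquiv (upperHalfPlaneSet \ Loewner.slidHull W A t) upperHalfPlaneSet) (d : ℝ),
        IsRestrictionMap (Loewner.slidHull W A t) Ψ → HasRestrictionDeriv (Loewner.slidHull W A t) Ψ d →
          d < ε := by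
  have hc' : 0 < 2 * c₁ := by linarith
  obtain ⟨θ, hθ1, hθ0, hpow⟩ := restrictionDeriv_le_pow hc'
  obtain ⟨N, hN⟩ := exists_pow_lt_of_lt_one hε hθ1
  obtain ⟨x, m, hxr, hxmono, hm, hlev⟩ := h.exists_scaleSeq hW hAarc hτ hreal hlim (2 * c₁)
  have hxmono' : Monotone x := monotone_nat_of_le_succ fun k ↦ (hxmono k).le
  -- `m` is nonincreasing
  have hm_anti : ∀ k ≤ N, m N ≤ m k := by
    intro k hk
    obtain ⟨-, -, z₀, hz₀, hz₀e⟩ := hm k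
    rw [← hz₀e]
    exact (hm N).2.1 z₀ (IsChainData.chain_mono (Λ := Λ) (β := β) (xs := xs) (hxmono' hk) hz₀)
  have hs₂ : 1 ≤ Real.sqrt (1 + (2 * c₁) ^ 2) := Real.one_le_sqrt.2 (by nlinarith)
  have hs₁ : 1 ≤ Real.sqrt (1 + c₁ ^ 2) := Real.one_le_sqrt.2 (by nlinarith)
  -- the error budget
  set ρN : ℝ := m N / (640 * Real.sqrt (1 + (2 * c₁) ^ 2)) with hρN
  have hρNpos : 0 < ρN := by rw [hρN]; exact div_pos (hm N).1 (by positivity)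
  set err : ℝ := ρN / (120 * Real.sqrt (1 + c₁ ^ 2)) with herr
  have herrpos : 0 < err := by rw [herr]; positivity
  -- the compact set `K = Γ_{x_N}` and the time window
  have hK : IsCompact (Λ ∪ β '' Icc xs (x N)) := h.isCompact_chain (hxr N).1 (hxr N).2.le
  have hKT : ∀ z ∈ Λ ∪ β '' Icc xs (x N), (τ : WithTop ℝ≥0) < Loewner.swallowingTime W z := fun z hz ↦
    h.lt_swallowingTime_of_mem_chain hW hAarc hτ hreal (hxr N).2 hz
  obtain ⟨δ, hδ, hunif⟩ := Loewner.exists_forall_norm_map_sub_map_lt hW hK hKT (half_pos herrpos)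
  obtain ⟨δW, hδW, hWc⟩ := Metric.continuous_iff.1 hW τ (err / 2) (half_pos herrpos)
  have hwindow : ∀ᶠ t : ℝ≥0 in 𝓝[<] τ, t < τ ∧ dist t τ < min δ δW := by
    filter_upwards [self_mem_nhdsWithin, mem_nhdsWithin_of_mem_nhds (Metric.ball_mem_nhds τ (lt_min hδ hδW))]
      with t ht ht'
    exact ⟨ht, ht'⟩
  filter_upwards [hwindow] with t ht
  obtain ⟨htτ, hdist⟩ := ht
  -- the total error at time `t` on `K`
  have htot : ∀ z ∈ Λ ∪ β '' Icc xs (x N),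
      ‖(Loewner.map W t z - W t) - (Loewner.map W τ z - W τ)‖ < err := by
    intro z hz
    have h1 : ‖Loewner.map W t z - Loewner.map W τ z‖ < err / 2 := by
      refine hunif t htτ.le ?_ z hz
      have : dist t τ = |(t : ℝ) - τ| := NNReal.dist_eq t τ
      have h2 : |(t : ℝ) - τ| < δ := by rw [← this]; exact lt_of_lt_of_le hdist (min_le_left _ _)
      linarith [(abs_lt.1 h2).1]
    have h2 : dist (W t) (W τ) < err / 2 := hWc t (lt_of_lt_of_le hdist (min_le_right _ _))
    rw [Real.dist_eq] at h2
    have h3 : ‖((W t : ℝ) : ℂ) - (W τ : ℝ)‖ < err / 2 := by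
      rw [← Complex.ofReal_sub, Complex.norm_real, Real.norm_eq_abs]; exact h2
    calc ‖(Loewner.map W t z - W t) - (Loewner.map W τ z - W τ)‖
        = ‖(Loewner.map W t z - Loewner.map W τ z) - ((W t : ℂ) - W τ)‖ := by ring_nf
      _ ≤ ‖Loewner.map W t z - Loewner.map W τ z‖ + ‖(W t : ℂ) - W τ‖ := norm_sub_le _ _
      _ < err / 2 + err / 2 := add_lt_add h1 h3
      _ = err := by ring
  -- the data of `restrictionDeriv_le_pow`
  set Af : ℕ → Set ℂ := fun k ↦ Loewner.slidHull W (Λ ∪ β '' Icc xs (x (min k N))) t with hAf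
  set sf : ℕ → ℝ := fun k ↦ m k / 2 with hsf
  set ρf : ℕ → ℝ := fun k ↦ m k / (640 * Real.sqrt (1 + (2 * c₁) ^ 2)) with hρf
  have hAf_eq : ∀ k ≤ N, Af k = Loewner.slidHull W (Λ ∪ β '' Icc xs (x k)) t := fun k hk ↦ by
    simp only [hAf, min_eq_left hk]
  have hρf_le : ∀ k ≤ N, ρN ≤ ρf k := fun k hk ↦ by
    simp only [hρN, hρf]
    exact div_le_div_of_nonneg_right (hm_anti k hk) (by positivity)
  have hstar : ∀ k ≤ N, IsStarHull (Af k) := fun k hk ↦ by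
    rw [hAf_eq k hk]
    exact (h.isStarHull_slidHull_chain hW hA hτ htτ (hxr k).1 (hxr k).2).1
  have hnest : ∀ k < N, Af k ⊆ Af (k + 1) := fun k hk ↦ by
    rw [hAf_eq k hk.le, hAf_eq (k + 1) hk]
    exact image_mono (IsChainData.chain_mono (Λ := Λ) (β := β) (xs := xs) (hxmono k).le)
  have hdisj : ∀ k < N, 0 < sf k ∧ Disjoint (ball (0 : ℂ) (sf k)) (Af k) := by
    intro k hk
    refine ⟨by simp only [hsf]; exact half_pos (hm k).1, ?_⟩
    rw [hAf_eq k hk.le, Set.disjoint_left]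
    rintro w hw ⟨z, hz, rfl⟩
    rw [mem_ball_zero_iff] at hw
    have hzN : z ∈ Λ ∪ β '' Icc xs (x N) := IsChainData.chain_mono (Λ := Λ) (β := β) (xs := xs) (hxmono' hk.le) hz
    have h1 := htot z hzN
    have h2 := (hm k).2.1 z hz
    have h3 := norm_sub_norm_le (Loewner.map W τ z - W τ) (Loewner.map W t z - W t)
    rw [norm_sub_rev] at h1
    have h4 : err ≤ m k / 4 := by
      have h5 : ρN ≤ m k / 640 := by
        rw [hρN]
        calc m N / (640 * Real.sqrt (1 + (2 * c₁) ^ 2)) ≤ m N / 640 :=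
              div_le_div_of_nonneg_left (hm N).1.le (by norm_num) (by nlinarith)
          _ ≤ m k / 640 := by gcongr; exact hm_anti k hk.le
      have h6 : err ≤ ρN := by
        rw [herr]; exact div_le_self hρNpos.le (by nlinarith)
      linarith [(hm k).1]
    simp only [hsf] at hw
    linarith
  have harc : ∀ k < N, ∃ (L : Set ℂ) (e : I ≃ₜ L), L ⊆ Af (k + 1) \ Af k ∧ 0 < ρf k ∧
      ρf k ≤ sf k / (320 * Real.sqrt (1 + (2 * c₁) ^ 2)) ∧
      (∀ z ∈ L, ρf k / 10 ≤ ‖z‖ ∧ ‖z‖ ≤ ρf k ∧ |z.re| ≤ (2 * c₁) * z.im) ∧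
      ‖((e 0 : L) : ℂ)‖ = ρf k ∧ ‖((e 1 : L) : ℂ)‖ = ρf k / 10 := by
    intro k hk
    have hρk : 0 < ρf k := lt_of_lt_of_le hρNpos (hρf_le k hk.le)
    have herrk : ∀ z ∈ Λ ∪ β '' Icc xs (x (k + 1)),
        ‖(Loewner.map W t z - W t) - (Loewner.map W τ z - W τ)‖ ≤ ρf k / (120 * Real.sqrt (1 + c₁ ^ 2)) := by
      intro z hz
      have hzN : z ∈ Λ ∪ β '' Icc xs (x N) :=
        IsChainData.chain_mono (Λ := Λ) (β := β) (xs := xs) (hxmono' (Nat.succ_le_of_lt hk)) hz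
      refine (htot z hzN).le.trans ?_
      rw [herr]
      exact div_le_div_of_nonneg_right (hρf_le k hk.le) (by positivity)
    obtain ⟨L, e, hL, hcone, he0, he1⟩ := h.exists_crossingArc hW hAarc hτ hreal hc₁ hstolz (hxr k).1 (hxmono k)
      (hxr (k + 1)).2 (hm k).2.1 hρk rfl (hlev k).1 htτ herrk
    refine ⟨L, e, ?_, hρk, le_of_eq ?_, hcone, he0, he1⟩
    · rw [hAf_eq k hk.le, hAf_eq (k + 1) hk]; exact hL
    · simp only [hρf, hsf]; field_simp; ring
  -- conclusion by monotonicity `A_N(t) ⊆ g_t(A) - W_t`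
  intro Ψ d hΨ hd
  have hQ : IsStarHull (Loewner.slidHull W A t) := hτ.isStarHull_slidHull hW hA htτ
  have hAN : IsStarHull (Af N) := hstar N le_rfl
  have hsub : Af N ⊆ Loewner.slidHull W A t := by
    rw [hAf_eq N le_rfl]
    exact (h.isStarHull_slidHull_chain hW hA hτ htτ (hxr N).1 (hxr N).2).2
  obtain ⟨ΦN, hΦN, -⟩ := IsStarHull.existsUnique_isRestrictionMap_holds hAN
  obtain ⟨dN, -, -, hdN⟩ := IsStarHull.exists_hasRestrictionDeriv_holds hAN hΦN
  calc d ≤ dN := hd.le_of_subset hQ hAN hsub hΨ hΦN hdN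
    _ ≤ θ ^ N := hpow N Af sf ρf hstar hnest hdisj harc hΦN hdN
    _ < ε := hN

end Final

/-! ### [LSW] Lemma 6.3 from the four named facts -/

/-- **[LSW] Lemma 6.3** (`IsSmoothHull.restrictionDerivVanishesAtHit`: for a smooth `*`-hull
`A` first met by the Loewner hull at time `T` without a real point of `A` being swallowed,
`Φ'_{g_t(A)}(W_t) → 0` as `t ↗ T`), **derived from** the hit-path facts
`IsSmoothHull.hitPath_tendsto`, `IsSmoothHull.hitPath_stolz` and the access facts
`IsSmoothHullWith.exists_smoothHitPath`, `IsArcHull.exists_accessArc`, by the analytic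
multi-scale argument of this tree (in place of the excursion argument in print).
[cite: LawlerSchrammWerner2003Restriction, Lemma 6.3] -/
theorem restrictionDerivVanishesAtHit_of_facts (h₁ : IsSmoothHull.hitPath_tendsto)
    (h₂ : IsSmoothHull.hitPath_stolz) (h₃ : IsSmoothHullWith.exists_smoothHitPath)
    (h₄ : IsArcHull.exists_accessArc) : IsSmoothHull.restrictionDerivVanishesAtHit := by
  intro A hAs hA W hW τ hτ hreal ε hε
  obtain ⟨γ, γ', hAw⟩ := isSmoothHull_iff.1 hAs
  have hAarc : IsArcHull A := hAs.isArcHull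
  -- the hit point `z₀ = γ s₀`
  obtain ⟨z₀, -, hz₀H, hz₀fr, hz₀T⟩ := hτ.exists_mem_frontier_swallowingTime_eq hW hAarc hreal
  have hz₀arc : z₀ ∈ γ '' Ioo 0 1 := by
    rw [← hAw.2.2.2.2.2.2.2.2]; exact ⟨hz₀H, hz₀fr⟩
  obtain ⟨s₀, hs₀, rfl⟩ := hz₀arc
  have hz₀K : γ s₀ ∈ Loewner.closedHull W τ := ⟨le_of_lt (show 0 < (γ s₀).im from hz₀H), hz₀T.le⟩
  -- the hit path and the access arc
  obtain ⟨β, β', hβ, hβi⟩ := h₃ hAw hs₀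
  have hlim := h₁ hW hAw hA hτ hreal hs₀ hz₀K hβ
  obtain ⟨c, hc⟩ := h₂ hW hAw hA hτ hreal hs₀ hz₀K hβ
  obtain ⟨η, xb, hηc, hηi, hη0, hη1, hxb, hηint⟩ := h₄ hAarc (hβ.mem_interior ⟨le_rfl, zero_lt_one⟩)
  have hβ1 : β 1 ∉ interior A := by
    rw [hβ.apply_one]
    exact fun hint ↦ (disjoint_interior_frontier (s := A)).le_bot ⟨hint, hz₀fr⟩
  have hβ1H : 0 < (β 1).im := by rw [hβ.apply_one]; exact hz₀H
  obtain ⟨Λ, xs, hchain⟩ := exists_isChainData hA.isBoundedHull hβ.continuousOn hβi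
    (fun x hx ↦ hβ.mem_interior hx) hβ1 hβ1H hηc hηi hη0 hη1 hxb hηint
  -- the Stolz constant, made `≥ 1`
  have hstolz : ∀ y ∈ Ico (0 : ℝ) 1,
      |(Loewner.map W τ (β y) - W τ).re| ≤ max c 1 * (Loewner.map W τ (β y) - W τ).im := by
    intro y hy
    have him : 0 < (Loewner.map W τ (β y) - W τ).im := by
      have hyint := hβ.mem_interior hy
      have hyH : 0 < (β y).im := im_pos_of_mem_interior_hull hA.isBoundedHull hyint
      have hyT := hτ.lt_swallowingTime_of_mem_interior hW hAarc hreal hyint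
      have hmem : β y ∈ Loewner.domain W τ := (Loewner.mem_domain_iff W τ _).2 ⟨hyH, hyT⟩
      have := Loewner.mapsTo_map hW τ hmem
      rw [Complex.sub_im, Complex.ofReal_im, sub_zero]
      exact this
    calc |(Loewner.map W τ (β y) - W τ).re| ≤ c * (Loewner.map W τ (β y) - W τ).im := hc y hy
      _ ≤ max c 1 * (Loewner.map W τ (β y) - W τ).im := by gcongr; exact le_max_left _ _
  exact hchain.eventually_restrictionDeriv_lt hW hA hAarc hτ hreal hlim (le_max_right c 1) hstolz hε

/-- **[LSW] Lemma 6.3 from three named facts**: as `restrictionDerivVanishesAtHit_of_facts`,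
with `IsSmoothHull.hitPath_tendsto` supplied by its proof `IsSmoothHull.hitPath_tendsto_holds`.
Remaining inputs: `IsSmoothHull.hitPath_stolz`, `IsSmoothHullWith.exists_smoothHitPath`,
`IsArcHull.exists_accessArc`. [cite: LawlerSchrammWerner2003Restriction, Lemma 6.3] -/
theorem restrictionDerivVanishesAtHit_of_stolz_access (h₂ : IsSmoothHull.hitPath_stolz)
    (h₃ : IsSmoothHullWith.exists_smoothHitPath) (h₄ : IsArcHull.exists_accessArc) :
    IsSmoothHull.restrictionDerivVanishesAtHit :=
  restrictionDerivVanishesAtHit_of_facts IsSmoothHull.hitPath_tendsto_holds h₂ h₃ h₄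

end Literature.Probability.RandomPlanarGeometry
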